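import Summits.ResolutionOfSingularities.ResolutionOfSingularities.Theorems.UniformComplexityCampaignW82TwistNormal
import Summits.ResolutionOfSingularities.ResolutionOfSingularities.Theorems.UniversalCellsCampaignW82KollarCurve
import HarnessLib

/-!
# [OURS · L1 W8.2] The surface `x^p − t = yz` over `K` is REGULAR when `X^p − t` is irreducible (and never smooth)

Cell `res-hironaka` (run/shared/lean/pub/res-hironaka/), LADDER-RESOLUTION rung L (RESCUE), slot W8.2 of
plan/RESCUE-SEED.md, door 2 = route `UniformComplexity`, host item `PrimeModelTransfer`
(stmt-ResolutionOfSingularities-8933); prover res-L1-s82-pv-2 (gen 4). THESES-FREE module (imports the gen-4 sibling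
`…TwistNormal` (the surface `Y_t`, its twists and base changes, `no_smooth_finite_model_twist`, `not_smooth_surfTo`,
`integralOverPerfectClosure_surf`, …), res-L1-s82-pv-1's `…KollarCurve` (the derivation lemma
`derivation_apply_mem_of_mem_sq`; through it the barrier file's `isRegularLocalRing_localization_map_mk`), Mathlib, `HarnessLib`).

[OURS · L1 W8.2] replaces the role of no printed item; NOT a statement of H. Hironaka's manuscript.

* §10 `not_mem_sq_of_pderiv_not_mem`: at a prime `Q` of `K[X_σ]`, `∂f/∂Xᵢ ∉ Q ⇒ f ∉ 𝔪_Q²` (any `σ`, any `f`).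
* §11 the inseparable point `P = (x^p − t, y, z)` of `Y_t` (`ptIdeal`, maximal for `X^p − t` irreducible; a prime
  containing `h_t`, `y`, `z` IS `P`: `eq_ptIdeal_of_mem`) and the thick point `K[X]/((X^p − t)²)` (`thickHom`,
  `thickLift`), which shows `h_t ∉ 𝔪_P²` (`surfPoly_not_mem_sq_ptIdeal`: the maximal ideal of `Y_t` at `P` is
  `(y, z)`) — the template is res-L1-s82-pv-1's `KollarCurveAnyField` thick point, one dimension up, credited.
* §12 **`isRegularRing_surfRing` / `isRegular_surf`**: for `X^p − t` irreducible over `K`, `K[x,y,z]/(x^p − t − yz)`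
  is a REGULAR ring (`∂h/∂y = −z`, `∂h/∂z = −y` off `P`; the thick point at `P`; Matsumura 14.2) — while `Y_t` is
  never smooth over `K` (`not_smooth_surfTo`): a regular, geometrically integral, NON-smooth SURFACE over `K`, the
  two-dimensional sibling of Kollár's curve `y² = x^p − t`.
* (sibling Theorems/UniformComplexityCampaignW82TwistNormalRung.lean, §13) level `0` and the packaged rung
  `normalisation_never_suffices p M` in the residual's own shape over `M(t)`.

HONEST FRAMING. OURS bookkeeping about an OURS statement; classical mathematics; NOT a statement of H. Hironaka's
2017 manuscript ([Hironaka2017]); nothing is attributed to its author. AI work, weaker than expert review. No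
`sorry`, no new axioms.

## References (vocabulary and locators only)
* J. Kollár, *Lectures on Resolution of Singularities* (2007), 1.19. [Kollar2007]
* H. Matsumura, *Commutative Ring Theory* (1986), Thms. 14.2, 19.4. [Matsumura1987]
* N. Shepherd-Barron, arXiv:1711.10439, Remark 2(1); Zs. Patakfalvi–J. Waldron, arXiv:1708.04268, §2.4.
* Cruxes/PrimeFieldToPerfect/Disproof.lean §4 (s2); L/res-L1-s82-pv-2/NOTES.md (gen 4).
-/

noncomputable section

set_option linter.dupNamespace false -- mandated namespace of this single-conjunct summit

open Polynomial IsLocalRing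
open _root_.CategoryTheory _root_.CategoryTheory.Limits _root_.AlgebraicGeometry
open Summit.ResolutionOfSingularities.ResolutionOfSingularities.Theorems.CampaignW82.KollarCurve
  (derivation_apply_mem_of_mem_sq)

namespace Summit.ResolutionOfSingularities.ResolutionOfSingularities.Theorems.CampaignW82.TwistNormal

open Literature.AlgebraicGeometry.Resolution

/-! ## §10 A Jacobian-type lemma: `∂f/∂Xᵢ ∉ Q` forces `f ∉ 𝔪_Q²` -/

section Jacobian

variable {K : Type} [Field K] {σ : Type}

/-- At a prime `Q` of `K[X_σ]`, if some partial `∂f/∂Xᵢ ∉ Q` then `f ∉ 𝔪_Q²` in `K[X]_Q` (a derivation maps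
`Q²` into `Q`). [folklore] -/
theorem not_mem_sq_of_pderiv_not_mem (f : MvPolynomial σ K) (Q : Ideal (MvPolynomial σ K)) [Q.IsPrime] (i : σ)
    (hD : MvPolynomial.pderiv i f ∉ Q) :
    algebraMap _ (Localization.AtPrime Q) f ∉ (maximalIdeal _) ^ 2 := by
  intro h
  rw [← Localization.AtPrime.map_eq_maximalIdeal, ← Ideal.map_pow,
    IsLocalization.mem_map_algebraMap_iff Q.primeCompl] at h
  obtain ⟨⟨⟨a, ha⟩, ⟨s, hs⟩⟩, h⟩ := h
  simp only at h
  rw [← map_mul] at h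
  have hinj : Function.Injective (algebraMap (MvPolynomial σ K) (Localization.AtPrime Q)) :=
    IsLocalization.injective _ Q.primeCompl_le_nonZeroDivisors
  have hmem : f * s ∈ Q ^ 2 := by rw [hinj h]; exact ha
  have hDm := derivation_apply_mem_of_mem_sq (MvPolynomial.pderiv i) Q hmem
  have hfQ : f ∈ Q := (Ideal.IsPrime.mem_or_mem ‹_› (Ideal.pow_le_self two_ne_zero hmem)).resolve_right hs
  rw [Derivation.leibniz, smul_eq_mul, smul_eq_mul] at hDm
  have h2 : s * MvPolynomial.pderiv i f ∈ Q := by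
    have h3 : f * MvPolynomial.pderiv i s ∈ Q := Q.mul_mem_right _ hfQ
    simpa using (Submodule.sub_mem _ hDm h3)
  exact hD ((Ideal.IsPrime.mem_or_mem ‹_› h2).resolve_left hs)

end Jacobian

/-! ## §11 The inseparable point `P = (x^p − t, y, z)` of `Y_t` and the thick point `K[X]/((X^p − t)²)` -/

section Point

variable (K : Type) [Field K] (p : ℕ) (t : K)

/-- `∂h_t/∂y = −z`. [folklore] -/
theorem pderiv_one_surfPoly : MvPolynomial.pderiv 1 (surfPoly K p t) = -MvPolynomial.X 2 := by
  have h10 : (0 : Fin 3) ≠ 1 := by decide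
  have h12 : (2 : Fin 3) ≠ 1 := by decide
  simp [surfPoly, Derivation.leibniz_pow, MvPolynomial.pderiv_X_of_ne h10, MvPolynomial.pderiv_X_of_ne h12]

/-- `∂h_t/∂z = −y`. [folklore] -/
theorem pderiv_two_surfPoly : MvPolynomial.pderiv 2 (surfPoly K p t) = -MvPolynomial.X 1 := by
  have h20 : (0 : Fin 3) ≠ 2 := by decide
  have h21 : (1 : Fin 3) ≠ 2 := by decide
  simp [surfPoly, Derivation.leibniz_pow, MvPolynomial.pderiv_X_of_ne h20, MvPolynomial.pderiv_X_of_ne h21]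

/-- Evaluation at the point `(t^{1/p}, 0, 0)`: `K[x,y,z] → K[X]/(X^p − t)`. [folklore] -/
def ptHom : MvPolynomial (Fin 3) K →ₐ[K] AdjoinRoot (X ^ p - C t : K[X]) :=
  MvPolynomial.aeval ![AdjoinRoot.root (X ^ p - C t : K[X]), 0, 0]

/-- The ideal `P ⊂ K[x,y,z]` of the point `(t^{1/p}, 0, 0)`. [folklore] -/
def ptIdeal : Ideal (MvPolynomial (Fin 3) K) := RingHom.ker (ptHom K p t)

/-- `ptHom` is surjective. [folklore] -/
theorem ptHom_surjective : Function.Surjective (ptHom K p t) := by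
  intro w
  induction w using AdjoinRoot.induction_on with
  | ih g =>
    refine ⟨Polynomial.aeval (MvPolynomial.X 0) g, ?_⟩
    rw [← Polynomial.aeval_algHom_apply]
    have : ptHom K p t (MvPolynomial.X 0) = AdjoinRoot.root (X ^ p - C t : K[X]) := by simp [ptHom]
    rw [this, AdjoinRoot.aeval_eq]

/-- `P` is maximal when `X^p − t` is irreducible. [folklore] -/
theorem ptIdeal_isMaximal (ht : Irreducible (X ^ p - C t : K[X])) : (ptIdeal K p t).IsMaximal := by
  haveI := Fact.mk ht
  exact RingHom.ker_isMaximal_of_surjective (ptHom K p t) (ptHom_surjective K p t)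

/-- `y ∈ P`, `z ∈ P`. [folklore] -/
theorem X_mem_ptIdeal (i : Fin 3) (hi : i ≠ 0) : (MvPolynomial.X i : MvPolynomial (Fin 3) K) ∈ ptIdeal K p t := by
  rw [ptIdeal, RingHom.mem_ker, ptHom, MvPolynomial.aeval_X]
  fin_cases i
  · exact absurd rfl hi
  · rfl
  · rfl

/-- `x^p − t ∈ P`. [folklore] -/
theorem gPoly_mem_ptIdeal : (MvPolynomial.X 0 ^ p - MvPolynomial.C t : MvPolynomial (Fin 3) K) ∈ ptIdeal K p t := by
  rw [ptIdeal, RingHom.mem_ker]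
  have h : ptHom K p t (MvPolynomial.X 0 ^ p - MvPolynomial.C t) =
      Polynomial.aeval (AdjoinRoot.root (X ^ p - C t : K[X])) (X ^ p - C t : K[X]) := by
    simp [ptHom]
  rw [h, AdjoinRoot.aeval_eq, AdjoinRoot.mk_self]

/-- `h_t ∈ P`. [folklore] -/
theorem surfPoly_mem_ptIdeal : surfPoly K p t ∈ ptIdeal K p t := by
  have : surfPoly K p t = (MvPolynomial.X 0 ^ p - MvPolynomial.C t) - MvPolynomial.X 1 * MvPolynomial.X 2 := rfl
  rw [this]
  exact Ideal.sub_mem _ (gPoly_mem_ptIdeal K p t)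
    (Ideal.mul_mem_left _ _ (X_mem_ptIdeal K p t 2 (by decide)))

/-- **A prime `Q ∋ h_t` of `K[x,y,z]` containing `y` and `z` is the point `P`** (`X^p − t` irreducible): the map
`K[x,y,z] → K[x,y,z]/Q` factors through `ptHom`. [folklore] -/
theorem eq_ptIdeal_of_mem (ht : Irreducible (X ^ p - C t : K[X])) (Q : Ideal (MvPolynomial (Fin 3) K)) [hQ : Q.IsPrime]
    (hh : surfPoly K p t ∈ Q) (h1 : MvPolynomial.X 1 ∈ Q) (h2 : MvPolynomial.X 2 ∈ Q) : Q = ptIdeal K p t := by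
  let ψ : MvPolynomial (Fin 3) K →ₐ[K] MvPolynomial (Fin 3) K ⧸ Q := Ideal.Quotient.mkₐ K Q
  have hψ1 : ψ (MvPolynomial.X 1) = 0 := Ideal.Quotient.eq_zero_iff_mem.mpr h1
  have hψ2 : ψ (MvPolynomial.X 2) = 0 := Ideal.Quotient.eq_zero_iff_mem.mpr h2
  have hψg : ψ (MvPolynomial.X 0 ^ p - MvPolynomial.C t) = 0 := by
    have : MvPolynomial.X 0 ^ p - MvPolynomial.C t = surfPoly K p t + MvPolynomial.X 1 * MvPolynomial.X 2 := by
      rw [surfPoly]; ring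
    rw [this, map_add, map_mul, hψ1, zero_mul, add_zero]
    exact Ideal.Quotient.eq_zero_iff_mem.mpr hh
  have hψX : (ψ (MvPolynomial.X 0)) ^ p = algebraMap K _ t := by
    rw [map_sub, map_pow, MvPolynomial.algHom_C, sub_eq_zero] at hψg
    exact hψg
  let χ : AdjoinRoot (X ^ p - C t : K[X]) →ₐ[K] MvPolynomial (Fin 3) K ⧸ Q :=
    AdjoinRoot.liftAlgHom (X ^ p - C t : K[X]) (Algebra.ofId K _) (ψ (MvPolynomial.X 0)) (by
      simp only [eval₂_sub, eval₂_X_pow, eval₂_C, hψX]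
      exact sub_self _)
  have hfac : χ.comp (ptHom K p t) = ψ := by
    refine MvPolynomial.algHom_ext fun i => ?_
    fin_cases i
    · simp [χ, ptHom, AdjoinRoot.liftAlgHom_root]
    · simp [ptHom, hψ1]
    · simp [ptHom, hψ2]
  have hle : ptIdeal K p t ≤ Q := by
    intro g hg
    have hg0 : ptHom K p t g = 0 := hg
    have : ψ g = 0 := by rw [← hfac, AlgHom.comp_apply, hg0, map_zero]
    exact Ideal.Quotient.eq_zero_iff_mem.mp this
  exact ((ptIdeal_isMaximal K p t ht).eq_of_le hQ.ne_top hle).symm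

/-! ### The thick point `T = K[X]/((X^p − t)²)` detects `h_t ∈ 𝔪_P ∖ 𝔪_P²` -/

/-- `T = K[X]/((X^p − t)²)`. [folklore] -/
abbrev thickPt : Type := AdjoinRoot ((X ^ p - C t : K[X]) ^ 2)

/-- `θ : K[x,y,z] → T`, `x ↦ X̄`, `y, z ↦ 0`. [folklore] -/
def thickHom : MvPolynomial (Fin 3) K →ₐ[K] thickPt K p t :=
  MvPolynomial.aeval ![AdjoinRoot.root ((X ^ p - C t : K[X]) ^ 2), 0, 0]

/-- The reduction `T → K[X]/(X^p − t)`. [folklore] -/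
def thickToPt : thickPt K p t →ₐ[K] AdjoinRoot (X ^ p - C t : K[X]) :=
  AdjoinRoot.algHomOfDvd K ((X ^ p - C t : K[X]) ^ 2) (X ^ p - C t) (dvd_pow_self _ two_ne_zero)

/-- The reduction on representatives. [folklore] -/
theorem thickToPt_mk (w : K[X]) : thickToPt K p t (AdjoinRoot.mk _ w) = AdjoinRoot.mk (X ^ p - C t : K[X]) w := by
  rw [thickToPt, AdjoinRoot.coe_algHomOfDvd, AdjoinRoot.liftAlgHom_mk, ← AdjoinRoot.aeval_eq, Polynomial.aeval_def]
  rfl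

/-- `reduction ∘ θ = ptHom`. [folklore] -/
theorem thickToPt_comp_thickHom : (thickToPt K p t).comp (thickHom K p t) = ptHom K p t := by
  refine MvPolynomial.algHom_ext fun i => ?_
  have hr : thickToPt K p t (AdjoinRoot.root _) = AdjoinRoot.root (X ^ p - C t : K[X]) := by
    have := thickToPt_mk K p t X; simpa using this
  fin_cases i
  · simp [thickHom, ptHom, hr]
  · simp [thickHom, ptHom]
  · simp [thickHom, ptHom]

/-- `θ(h_t)` is the class of `X^p − t` in `T`. [folklore] -/
theorem thickHom_surfPoly : thickHom K p t (surfPoly K p t) = AdjoinRoot.mk ((X ^ p - C t : K[X]) ^ 2) (X ^ p - C t) := by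
  rw [← AdjoinRoot.aeval_eq]
  simp [thickHom, surfPoly]

/-- … which is non-zero (`(X^p − t)² ∤ (X^p − t)` for `X^p − t` irreducible). [folklore] -/
theorem mk_insep_ne_zero (ht : Irreducible (X ^ p - C t : K[X])) :
    AdjoinRoot.mk ((X ^ p - C t : K[X]) ^ 2) (X ^ p - C t) ≠ 0 := by
  rw [Ne, AdjoinRoot.mk_eq_zero]
  rintro ⟨c, hc⟩
  have h1 : (X ^ p - C t : K[X]) * 1 = (X ^ p - C t) * ((X ^ p - C t) * c) := by
    rw [mul_one, ← mul_assoc, ← pow_two]; exact hc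
  have h2 : (1 : K[X]) = (X ^ p - C t) * c := mul_left_cancel₀ ht.ne_zero h1
  exact ht.not_isUnit (IsUnit.of_mul_eq_one c h2.symm)

/-- Elements outside `P` become units in `T` (Bézout). [folklore] -/
theorem isUnit_thickHom (ht : Irreducible (X ^ p - C t : K[X])) {u : MvPolynomial (Fin 3) K} (hu : u ∉ ptIdeal K p t) :
    IsUnit (thickHom K p t u) := by
  obtain ⟨w, hw⟩ := AdjoinRoot.mk_surjective (thickHom K p t u)
  have hne : AdjoinRoot.mk (X ^ p - C t : K[X]) w ≠ 0 := by
    intro h0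
    apply hu
    change ptHom K p t u = 0
    rw [← thickToPt_comp_thickHom, AlgHom.comp_apply, ← hw, thickToPt_mk, h0]
  have hndvd : ¬ (X ^ p - C t : K[X]) ∣ w := by rwa [← AdjoinRoot.mk_eq_zero]
  have hcop : IsCoprime (X ^ p - C t : K[X]) w := (ht.coprime_iff_not_dvd).mpr hndvd
  obtain ⟨a, b, hab⟩ := hcop.pow_left (m := 2)
  rw [← hw]
  have h1 := congrArg (AdjoinRoot.mk ((X ^ p - C t : K[X]) ^ 2)) hab
  rw [map_add, map_mul, map_mul, AdjoinRoot.mk_self, mul_zero, zero_add, map_one] at h1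
  exact IsUnit.of_mul_eq_one (AdjoinRoot.mk _ b) (by rw [mul_comm]; exact h1)

/-- `θ̃ : K[x,y,z]_P → T`. [folklore] -/
def thickLift (ht : Irreducible (X ^ p - C t : K[X])) :
    haveI := (ptIdeal_isMaximal K p t ht).isPrime
    Localization.AtPrime (ptIdeal K p t) →+* thickPt K p t :=
  haveI := (ptIdeal_isMaximal K p t ht).isPrime
  IsLocalization.lift (M := (ptIdeal K p t).primeCompl) (S := Localization.AtPrime (ptIdeal K p t))
    (g := (thickHom K p t).toRingHom) (fun y => isUnit_thickHom K p t ht y.prop)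

/-- `θ(P) ⊆ (X̄^p − t) T`. [folklore] -/
theorem thickHom_mem_of_mem_ptIdeal {x : MvPolynomial (Fin 3) K} (hx : x ∈ ptIdeal K p t) :
    thickHom K p t x ∈ Ideal.span {AdjoinRoot.mk ((X ^ p - C t : K[X]) ^ 2) (X ^ p - C t)} := by
  obtain ⟨w, hw⟩ := AdjoinRoot.mk_surjective (thickHom K p t x)
  have h0 : AdjoinRoot.mk (X ^ p - C t : K[X]) w = 0 := by
    rw [← thickToPt_mk, hw, ← AlgHom.comp_apply, thickToPt_comp_thickHom]
    exact hx
  obtain ⟨w', rfl⟩ := AdjoinRoot.mk_eq_zero.mp h0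
  rw [← hw, map_mul]
  exact Ideal.mul_mem_right _ _ (Ideal.subset_span rfl)

/-- **`h_t ∉ 𝔪_P²`** in `K[x,y,z]_P` (`θ̃(h_t) = X̄^p − t ≠ 0` while `θ̃(𝔪_P²) = 0`): at the inseparable point the
maximal ideal of `Y_t` is `(y, z)`. [folklore] -/
theorem surfPoly_not_mem_sq_ptIdeal (ht : Irreducible (X ^ p - C t : K[X])) :
    haveI := (ptIdeal_isMaximal K p t ht).isPrime
    algebraMap _ (Localization.AtPrime (ptIdeal K p t)) (surfPoly K p t) ∉ (maximalIdeal _) ^ 2 := by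
  haveI := (ptIdeal_isMaximal K p t ht).isPrime
  intro h
  have hle : (maximalIdeal (Localization.AtPrime (ptIdeal K p t))).map (thickLift K p t ht) ≤
      Ideal.span {AdjoinRoot.mk ((X ^ p - C t : K[X]) ^ 2) (X ^ p - C t)} := by
    rw [← Localization.AtPrime.map_eq_maximalIdeal, Ideal.map_map, Ideal.map_le_iff_le_comap]
    intro x hx
    rw [Ideal.mem_comap, RingHom.comp_apply, thickLift, IsLocalization.lift_eq]
    exact thickHom_mem_of_mem_ptIdeal K p t hx
  have h1 : thickLift K p t ht (algebraMap _ _ (surfPoly K p t)) ∈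
      ((maximalIdeal (Localization.AtPrime (ptIdeal K p t))).map (thickLift K p t ht)) ^ 2 := by
    rw [← Ideal.map_pow]; exact Ideal.mem_map_of_mem _ h
  have h2 := Ideal.pow_right_mono hle 2 h1
  rw [Ideal.span_singleton_pow, ← map_pow, AdjoinRoot.mk_self, Ideal.span_singleton_eq_bot.mpr rfl,
    Ideal.mem_bot, thickLift, IsLocalization.lift_eq, AlgHom.toRingHom_eq_coe, RingHom.coe_coe,
    thickHom_surfPoly] at h2
  exact mk_insep_ne_zero K p t ht h2

end Point

/-! ## §12 `Y_t` is REGULAR for `X^p − t` irreducible -/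

section Regular

variable (K : Type) [Field K] (p : ℕ) (t : K)

/-- **At every prime `Q ∋ h_t` of `K[x,y,z]`, `h_t ∉ 𝔪_Q²`** (`X^p − t` irreducible): if `z ∉ Q` or `y ∉ Q` by
the partials `∂h/∂y = −z`, `∂h/∂z = −y`; otherwise `Q = P` and by the thick point. [folklore] -/
theorem surfPoly_not_mem_sq (ht : Irreducible (X ^ p - C t : K[X])) (Q : Ideal (MvPolynomial (Fin 3) K)) [Q.IsPrime]
    (hh : surfPoly K p t ∈ Q) :
    algebraMap _ (Localization.AtPrime Q) (surfPoly K p t) ∉ (maximalIdeal _) ^ 2 := by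
  by_cases h2 : MvPolynomial.X 2 ∈ Q
  · by_cases h1 : MvPolynomial.X 1 ∈ Q
    · obtain rfl := eq_ptIdeal_of_mem K p t ht Q hh h1 h2
      exact surfPoly_not_mem_sq_ptIdeal K p t ht
    · exact not_mem_sq_of_pderiv_not_mem _ Q 2 (by rw [pderiv_two_surfPoly]; exact fun h => h1 (by simpa using h))
  · exact not_mem_sq_of_pderiv_not_mem _ Q 1 (by rw [pderiv_one_surfPoly]; exact fun h => h2 (by simpa using h))

/-- **`K[x,y,z]/(x^p − t − yz)` is a REGULAR ring when `X^p − t` is irreducible over `K`** (Matsumura 14.2 at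
every prime via `surfPoly_not_mem_sq`, transported by the barrier file's `isRegularLocalRing_localization_map_mk`).
[folklore] -/
theorem isRegularRing_surfRing (ht : Irreducible (X ^ p - C t : K[X])) :
    IsRegularRing (HypRing K (surfPoly K p t)) := by
  rw [isRegularRing_iff]
  intro Q hQ
  set Q₀ := Q.comap (Ideal.Quotient.mk (Ideal.span {surfPoly K p t})) with hQ₀
  have hfQ₀ : Ideal.span {surfPoly K p t} ≤ Q₀ := by
    rw [hQ₀, ← Ideal.map_le_iff_le_comap, Ideal.map_quotient_self]
    exact bot_le
  have hQeq : Q₀.map (Ideal.Quotient.mk (Ideal.span {surfPoly K p t})) = Q :=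
    Ideal.map_comap_of_surjective _ Ideal.Quotient.mk_surjective Q
  have key : IsRegularLocalRing (Localization.AtPrime Q₀ ⧸
      (Ideal.span {surfPoly K p t}).map (algebraMap _ (Localization.AtPrime Q₀))) := by
    rw [Ideal.map_span, Set.image_singleton]
    have hmem : algebraMap _ (Localization.AtPrime Q₀) (surfPoly K p t) ∈ maximalIdeal _ := by
      rw [← Localization.AtPrime.map_eq_maximalIdeal]
      exact Ideal.mem_map_of_mem _ (hfQ₀ (Ideal.subset_span rfl))
    exact (IsRegularLocalRing.quotient_span_singleton hmem
      (surfPoly_not_mem_sq K p t ht Q₀ (hfQ₀ (Ideal.subset_span rfl)))).1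
  haveI : (Q₀.map (Ideal.Quotient.mk (Ideal.span {surfPoly K p t}))).IsPrime := by rw [hQeq]; exact hQ
  have h := Literature.Barriers.ResolutionOfSingularities.isRegularLocalRing_localization_map_mk
    (Ideal.span {surfPoly K p t}) Q₀ hfQ₀ key
  have hS : (Q₀.map (Ideal.Quotient.mk (Ideal.span {surfPoly K p t}))).primeCompl = Q.primeCompl := by
    ext x; simp [Ideal.primeCompl, hQeq]
  haveI : IsLocalization.AtPrime
      (Localization.AtPrime (Q₀.map (Ideal.Quotient.mk (Ideal.span {surfPoly K p t})))) Q := by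
    change IsLocalization Q.primeCompl _
    rw [← hS]
    infer_instance
  exact IsRegularLocalRing.of_ringEquiv
    (R := Localization.AtPrime (Q₀.map (Ideal.Quotient.mk (Ideal.span {surfPoly K p t}))))
    (IsLocalization.algEquiv Q.primeCompl
      (Localization.AtPrime (Q₀.map (Ideal.Quotient.mk (Ideal.span {surfPoly K p t}))))
      (Localization.AtPrime Q)).toRingEquiv

/-- **`Y_t` is a REGULAR scheme for `X^p − t` irreducible over `K`** — yet never smooth over `K`
(`not_smooth_surfTo`): a regular, geometrically integral, non-smooth SURFACE. [folklore] -/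
theorem isRegular_surf (ht : Irreducible (X ^ p - C t : K[X])) : Scheme.IsRegular (surf K p t) :=
  haveI := isRegularRing_surfRing K p t ht
  Scheme.isRegular_Spec _

end Regular

end Summit.ResolutionOfSingularities.ResolutionOfSingularities.Theorems.CampaignW82.TwistNormal

end
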